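import Literature.IUT.HodgeTheaters.GoodLocalFrobenioidOfKitSplitTransport
import Literature.IUT.HodgeTheaters.GoodLocalFrobenioidOfKitQpCdash
import Literature.IUT.HodgeTheaters.GoodLocalFrobenioidOfKitSplitNegative
import HarnessLib

/-!
# [IUTchI] Example 3.3 (iii) (e): the binder `hfix` of the split criterion is LOAD-BEARING — at the degenerate real
# instance `GoodLocalFrobenioid.ofKitQp p` some self-equivalence of `C_v = C(ℚ_p)` does NOT preserve `τ_{p}`

Mochizuki, *Inter-universal Teichmüller theory I*, kurims manuscript (May 2020), Example 3.3 (iii) (e), p. 79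
[claim: Mochizuki2012, status: disputed]; Mochizuki, *The geometry of Frobenioids II*, Kyushu J. Math. **62** (2008),
Remark 1.2.2 p. 10 [cite: MochizukiFrdII2008, Rmk 1.2.2 p.10] (the unit twist `Ψ_U`; kurims ms p. 10 l. 33–35:
"`p ∈ ℚ_p^×` is mapped to some `p · u ∈ ℚ_p^×`, where `u ∈ ℤ_p^×`").
Nothing of the series is asserted; no side is taken on [IUTchIII] Cor. 3.12.

PROOF-ONLY tightness record (abc-iut cell, seat abc-iut-w4-d047 gen 5; row E33iii/e of
`plan/L5/SUBDAG-IUTchI-Ex33-Ex34.md`), 0 definitions, no new Prop fact.  This lineage's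
`GoodLocalFrobenioid.splitFromF_ofKit_of_isPreservedBy` (`GoodLocalFrobenioidOfKitSplitTransport.lean`) proves clause (e)
`SplitFromF` at every `ofKit` from clause (d) and ONE binder `hfix` ("every self-equivalence of the PERFECT `p_v`-adic
Frobenioid `C_v` preserves `τ_{p_v}`").  At the degenerate [FrdII] instance `ofKitQp p` (one-object base `Spec ℚ_p`)
clause (d) HOLDS (`cdashFromF_ofKitQp`, gen 2 of this lineage) while clause (e) FAILS (`not_splitFromF_ofKitQp`: the
[FrdII] Rmk. 1.2.2 unit twist `p ↦ -p`); hence `hfix` FAILS there: the binder is not vacuous filler but carries exactly the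
anabelian content ([AbsTopIII] Prop. 3.2 (iii) at the genuine `Π_v`) that separates the genuine datum from `Spec ℚ_p`.
-/

namespace Literature.IUT.HodgeTheaters

namespace GoodLocalFrobenioid

open CategoryTheory Opposite Literature.AlgebraicGeometry.Frobenioids Literature.AlgebraicGeometry.Frobenioids.PadicFrd

variable (p : ℕ) [Fact p.Prime]

/-- **`hfix` FAILS at `ofKitQp p`**: NOT every self-equivalence of the real `p`-adic Frobenioid `C(ℚ_p) = C_v` of
`ofKitQp p` preserves the splitting `τ_p` of `C_v` (else, by `splitFromF_ofKit_of_isPreservedBy` and `cdashFromF_ofKitQp`,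
clause (e) would hold at `ofKitQp p`, contradicting `not_splitFromF_ofKitQp` — the [FrdII] Rmk. 1.2.2 twist `p ↦ -p`).
([IUTchI] Ex 3.3 (iii) (e) p.79) [claim: Mochizuki2012, status: disputed] -/
theorem not_forall_isPreservedBy_pSplitting_ofKitQp :
    ¬ ∀ e : (ofKitQp p).Cv ≌ (ofKitQp p).Cv,
      S3Local.CharSplitting.IsPreservedBy
        ⟨(Datum.perf (𝟭 (Discrete PUnit.{1}) ⋙ qpBase p)
            (hlocOver (𝟭 (Discrete PUnit.{1})) (qpBase p) (fun _ => isPadicLocal_qpFld p))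
            inferInstance isTotallyEpimorphic_discretePUnit).pSplittingSubmonoid⟩
        ⟨(Datum.perf (𝟭 (Discrete PUnit.{1}) ⋙ qpBase p)
            (hlocOver (𝟭 (Discrete PUnit.{1})) (qpBase p) (fun _ => isPadicLocal_qpFld p))
            inferInstance isTotallyEpimorphic_discretePUnit).pSplittingSubmonoid⟩ e.functor :=
  fun hfix => not_splitFromF_ofKitQp p
    (splitFromF_ofKit_of_isPreservedBy (𝟭 (Discrete PUnit.{1})) (𝟭 _) Adjunction.id (qpBase p)
      (fun _ => isPadicLocal_qpFld p) inferInstance isTotallyEpimorphic_discretePUnit inferInstance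
      isTotallyEpimorphic_discretePUnit ℚ_[p] (p_mem_intNonzero p) (cdashFromF_ofKitQp p) hfix)

/-- Hence, at `ofKitQp p`, SOME self-equivalence of `C_v` moves `τ_p` (an explicit one is the unit twist `twistEquiv p`
of `GoodLocalFrobenioidOfKitQpTwist.lean`). ([IUTchI] Ex 3.3 (iii) (e) p.79) [claim: Mochizuki2012, status: disputed] -/
theorem exists_equivalence_not_isPreservedBy_pSplitting_ofKitQp :
    ∃ e : (ofKitQp p).Cv ≌ (ofKitQp p).Cv,
      ¬ S3Local.CharSplitting.IsPreservedBy
        ⟨(Datum.perf (𝟭 (Discrete PUnit.{1}) ⋙ qpBase p)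
            (hlocOver (𝟭 (Discrete PUnit.{1})) (qpBase p) (fun _ => isPadicLocal_qpFld p))
            inferInstance isTotallyEpimorphic_discretePUnit).pSplittingSubmonoid⟩
        ⟨(Datum.perf (𝟭 (Discrete PUnit.{1}) ⋙ qpBase p)
            (hlocOver (𝟭 (Discrete PUnit.{1})) (qpBase p) (fun _ => isPadicLocal_qpFld p))
            inferInstance isTotallyEpimorphic_discretePUnit).pSplittingSubmonoid⟩ e.functor :=
  not_forall.mp (not_forall_isPreservedBy_pSplitting_ofKitQp p)

end GoodLocalFrobenioid

end Literature.IUT.HodgeTheaters
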